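/-
Copyright (c) 2026 the pub-hodgecm-mathlib formalisation cell (harness21).  Prover seat hodgecm-mathlib-K2Liu-p05 (g8), Track B «K2-LIT»,
#184♮ = hLiu418 = `stmt-HodgeConjecture-24832`; #42F′ FACE-G organ F4 (G-gen), B3-b letters (D-let)+(one-place) DIRECTED: ★ `K2LiuArchSWDataDerivLetters` §2 and ★
`K2LiuArchSWDataOnePlaceLetter` re-run with the direction predicate `DX` of ★ F1 ED. 2 `K2LiuFaceGAssemblerDirected.faceG_of_organs_directed` (F4 desk K2Liu-p27 (g3)
RULING F4-DX «L3 OF RECORD IS DIRECTED» + WORD #1 (a), 2026-09-05T00:36:27Z; consumer LH7-p07 (g2) `K2LiuArchSWDataInductionDirected`).  THEOREMS ONLY (no `def`, no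
`instance`, no notation, no local instance, no named-fact hypothesis, no `sorry`); lane `--supports stmt-HodgeConjecture-24832 --as helper`.
-/
import Summits.HodgeConjecture.HodgeConjecture.Theorems.K2LiuArchSWDataDerivLetters      -- ★ (D-let): `frame_tupleVec_update` + the (T2)∕GenFamily machinery it imports
import Summits.HodgeConjecture.HodgeConjecture.Theorems.K2LiuArchSWDataOnePlaceLetter    -- ★ `relabel_symm_symm_apply` + ★ `hsec_placeSec_relabel`, ★ F2, ★ `exists_archSkew_archExp_eq_placeSecJ_expMem`
import HarnessLib

/-!
# Crux `HLiu418`, FACE-G organ F4 (G-gen), B3-b: the derivative letters (DX⁺)(DX⁻) and the one-place letter, DIRECTED — with the direction predicate `DX`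

Cell `hodgecm-mathlib`, crux item hLiu418 = `stmt-HodgeConjecture-24832`; squad K2 ∕ K2Liu; prover K2Liu-p05 (g8); F4 desk K2Liu-p27 (g3); consumer LH7-p07 (g2)
(`K2LiuArchSWDataInductionDirected.good_tupleVec_of_frame_directed ∕ good_tupleVec_directed ∕ good_tupleVec_of_hermiteData_directed`); box K2E5-r02 ∕ K2Liu-audit1.

WHY.  The #42F′ tie of record is the DIRECTED FACE-G assembler ★ `faceG_of_organs_directed (DX) (HL)`: its L3 binder hands F4 a (deriv) closure letter RESTRICTED to
directions `X` with `DX X` (★ :223 `(_hXD : DX L e dV hdV dW hdW X)`), so every (DX±) letter F4 produces must CERTIFY `DX X` for its witness `X`.  Road (E) differentiates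
only along the chart images at the junction frames (`archExp hX s = archEmb (placeSecJ_𝔻 σ (eSp σ)⁻¹ (eSq σ)⁻¹ (exp sY, 1))`, ★ `exists_archSkew_archExp_eq_placeSecJ_expMem`),
so ONE letter **`hDX`** «`DX` sees the chart images at the junction frames» (antecedent = that ★ theorem's first conjunct verbatim; at the single-place predicate `DX′` of
★ `K2LiuArchSkewPlaceChart` it is its constructor, at `DX := ⊤` trivial) makes the whole (DX±) column directed.  `DX` is a LOCAL predicate
`(DX : Matrix (Fin (n + n)) (Fin (n + n)) (mixedSpace L) → Prop)` here (F4-END feeds F1's family applied, `DX L e dV hdV dW hdW`).  ZERO new mathematics: the proofs are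
★ (D-let) §2's and ★ `onePlaceLetter_of_junctionFrames`'s, threading the extra conjunct.
* §1 (FACE-G shapes, generic place frames `R S eP eQ` as ★ FILE 2c) **`hDXp_directed_of_onePlaceLetter (DX) (ht hodd) (hψ_D)`**, **`hDXm_directed_of_onePlaceLetter`** —
  ★ FILE 2c `good_tupleVec`'s `hDXp ∕ hDXm` binder bytes with `DX X ∧` inserted as FIRST conjunct after `∃ X hX c G,`, from the directed one-place letter `hψ_D` := ★
  (D-let)'s `hψ` whose clause (b) reads `∀ Y, ∃ X hX c, DX X ∧ (∀ s, archExp hX s = archEmb (ψ_σ (exp sY))) ∧ HasDerivAt (detChar α ∘ archExp hX) c 0`.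
* §2 (generic shapes) **`onePlaceLetter_directed_of_junctionFrames (DX) (hα) (y hy hz eP₀ eQ₀ hE) (eSp eSq) (hDX)`** : `hψ_D` at the junction frames of record
  (`R σ := PosIdx (y σ)`, `S σ := NegIdx (y σ)`, `eP σ := (eP₀ σ)⁻¹ ≫ ((eSp σ)⁻¹ × 1 ⊕ (eSq σ)⁻¹ × 1)`, `eQ σ` twin; F4 FRAMES OF RECORD 2026-09-05T00:19:48Z) — ★
  `onePlaceLetter_of_junctionFrames`'s proof with `hDX σ Y X hX hcurve` supplying the new conjunct (`hDX` is the LAST binder: it mentions `eSp eSq`).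
* §3 (edition 2) **`onePlaceLetter_directed_of_junctionFrames' (DX) (hα) (y hy hz eP₀ eQ₀ hE) (eSp eSq) (hDX)`** — the same, with `hDX` receiving ALSO the single-place
  support clause `∀ w ≠ cmPlaceOver L σ, X.map (evalC L w) = 0` of ★ `exists_archSkew_archExp_eq_placeSecJ_expMem` (its second conjunct), so that the SINGLE-PLACE direction
  predicate of record is served by name (box K2E5-r02 junction J2, exit (E1)).
So in the directed Final: `hDXp := hDXp_directed_of_onePlaceLetter … (fun σ => PosIdx (y σ)) (fun σ => NegIdx (y σ)) (eP) (eQ) DX ht hodd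
(onePlaceLetter_directed_of_junctionFrames … DX hα y hy hz eP₀ eQ₀ hE eSp eSq hDX)` and the `hDXm` twin.
References: [KudlaRallis1994, §1]; [Folland1989, §4.2 Prop. (4.39)]; [Howe1989, §3]; [KonnoKonno2007, §3.1 (3.1), §3.3, Lemma 5.2]; [BorelJacquet1979, §4.1];
[Knapp2002, Introduction §2 Prop. 0.11].
HONEST LABEL.  Count-neutral helper: `HC_CM` is proved only modulo the 7 printed citations (2 remaining named inputs: hLiu418 = `stmt-HodgeConjecture-24832`,
h413 = `stmt-HodgeConjecture-24833`) until rung 0 closes; this file closes no socket.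
-/

set_option autoImplicit false
set_option linter.dupNamespace false -- the mandated namespace repeats `HodgeConjecture.HodgeConjecture`

noncomputable section
open scoped Classical Matrix TensorProduct Kronecker SchwartzMap MatrixGroups Real
open NumberField NumberField.InfinitePlace NumberField.mixedEmbedding IsDedekindDomain MvPolynomial
open Literature.Analysis.SegalBargmann Literature.Analysis.Distribution Literature.RepresentationTheory.HeisenbergGroup
open Literature.NumberTheory.Automorphic Literature.NumberTheory.Automorphic.UnitaryGroup Literature.NumberTheory.GaloisRepresentations
open Literature.NumberTheory.Weil1964 Literature.NumberTheory.Weil1964.MpS Literature.NumberTheory.Weil1964.UnitaryWeil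
open Literature.RepresentationTheory.HarrisKudlaSweet1996
open Literature.RepresentationTheory.KonnoKonno2007 hiding LetterKind letterOf letterGen letterOf_boost letterOf_torus letterOf_torus_eq
  letterGen_boost letterGen_torus letterGen_mem_lie exp_smul_letterGen
open Literature.RepresentationTheory.KonnoKonno2007.RealDualPair Literature.NumberTheory.K2Lit.SiegelDoubled
open Literature.NumberTheory.GelbartRogawski1991 Literature.NumberTheory.GelbartRogawski1991.GRConstruction Literature.NumberTheory.GelbartRogawski1991.UnitaryDualPair
open Literature.NumberTheory.GelbartRogawski1991.UnitaryDualPair.LocalSplitting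
open Literature.NumberTheory.Automorphic.Liu2021 Literature.NumberTheory.Automorphic.Liu2021.Def411WeilCarriers Literature.NumberTheory.Automorphic.Liu2021.Def411WeilCarriersDoubling
open Summit.HodgeConjecture.HodgeConjecture.Cruxes.HLiu418.K2LiuArchSectionPlaceBlock
open Summit.HodgeConjecture.HodgeConjecture.Cruxes.HLiu418 (K2LiuArchOneParameterOrbitDefs.archEmb K2LiuArchOneParameterOrbitDefs.archExp)
open Summit.HodgeConjecture.HodgeConjecture.Cruxes.HLiu418.K2LiuSwSectionArchOrbit Summit.HodgeConjecture.HodgeConjecture.Cruxes.HLiu418.K2LiuArchWeilJunctionTransport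
open Summit.HodgeConjecture.HodgeConjecture.Cruxes.HLiu418.K2LiuFaceGLetterDefs (genFamily HasArchDeriv)
open Summit.HodgeConjecture.HodgeConjecture.Cruxes.HLiu418.K2LiuU22AdaptedBasis (boostGen boostGen_mem_lie)
open Summit.HodgeConjecture.HodgeConjecture.Cruxes.HLiu418.K2LiuArchSWPlaceTransport
open Summit.HodgeConjecture.HodgeConjecture.Cruxes.HLiu418.K2LiuArchSWPlaceTransportGenFamily (hasArchDeriv_genFamily_fock_of_weakDeriv)
open Summit.HodgeConjecture.HodgeConjecture.Cruxes.HLiu418.K2LiuArchSWDataTuplesDefs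
open Summit.HodgeConjecture.HodgeConjecture.Cruxes.HLiu418.K2LiuArchSWDataDerivLetters (frame_tupleVec_update)
open Summit.HodgeConjecture.HodgeConjecture.Cruxes.HLiu418.K2LiuArchJunctionFrameData (hsec_placeSec_relabel)
open Summit.HodgeConjecture.HodgeConjecture.Cruxes.HLiu418.K2LiuSwSectionTensorArchOrbitDeriv (hasDerivAt_coe_detChar_archExp)
open Summit.HodgeConjecture.HodgeConjecture.Cruxes.HLiu418.K2LiuArchSWDataOnePlaceLetter (relabel_symm_symm_apply)

namespace Summit.HodgeConjecture.HodgeConjecture.Cruxes.HLiu418.K2LiuArchSWDataDerivLettersDirected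

-- the CM sign frames and the three relabellings elaborate slowly (as ★ (D-let) ∕ ★ FILE 2c ∕ ★ `onePlaceLetter_of_junctionFrames`: 4 000 000 heartbeats on the statements)
set_option maxHeartbeats 4000000

/-! ## §1 The two directed derivative letters from the directed one-place letter `hψ_D` (FACE-G shapes, generic place frames) -/

section FaceG

variable (L : Type) [Field L] [NumberField L] [IsCMField L] {n : ℕ} (e : Fin 2 × Fin 1 ≃ Fin n)
  (dV : Fin 2 → L) (hdV : ∀ i, IsCMField.complexConj L (dV i) = dV i) (hdV0 : ∀ i, dV i ≠ 0)
  (dW : Fin 1 → L) (hdW : ∀ i, IsCMField.complexConj L (dW i) = dW i) (hdW0 : ∀ i, dW i ≠ 0)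
  {M' n' : ℕ} (eW : Fin 1 × Fin 3 ≃ Fin M') (e' : Fin 2 × Fin M' ≃ Fin n')
  (dV' : Fin 3 → L) (hdV' : ∀ k, IsCMField.complexConj L (dV' k) = dV' k) (hdV'0 : ∀ k, dV' k ≠ 0)
  (χb : HeckeCharacter L) (hχbu : χb.IsUnitary) (hχbs : IsSplittingChar L 1 χb)
  (α : UnitaryGroup.adelicOne (Fp L) L (IsCMField.complexConj L) →* ℂˣ) (𝒦 : IwasawaDatum L e dV hdV dW hdW)
  (R S : {v : InfinitePlace (Fp L) // v.IsReal} → Type) [∀ σ, Fintype (R σ)] [∀ σ, DecidableEq (R σ)] [∀ σ, Fintype (S σ)] [∀ σ, DecidableEq (S σ)]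
  (eP : ∀ σ : {v : InfinitePlace (Fp L) // v.IsReal}, PosIdx (signVec (cmPlaceOver L) (fun k => Sum.elim (cmGramEntry L e' dV hdV (tensorFrame L dW eW dV') (tensorFrame_real L dW hdW eW dV' hdV')) (-cmGramEntry L e' dV hdV (tensorFrame L dW eW dV') (tensorFrame_real L dW hdW eW dV' hdV')) ((LocalSplitting.e₂ n').symm k)) (imagUnit L) σ) ≃ (Fin 2 × R σ) ⊕ (Fin 2 × S σ))
  (eQ : ∀ σ : {v : InfinitePlace (Fp L) // v.IsReal}, NegIdx (signVec (cmPlaceOver L) (fun k => Sum.elim (cmGramEntry L e' dV hdV (tensorFrame L dW eW dV') (tensorFrame_real L dW hdW eW dV' hdV')) (-cmGramEntry L e' dV hdV (tensorFrame L dW eW dV') (tensorFrame_real L dW hdW eW dV' hdV')) ((LocalSplitting.e₂ n').symm k)) (imagUnit L) σ) ≃ (Fin 2 × S σ) ⊕ (Fin 2 × R σ))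

include hdW0 hdV'0 in
/-- **(DX⁺) AT THE MODEL, DIRECTED — ★ FILE 2c `good_tupleVec`'s binder `hDXp` BYTES with `DX X ∧` as first conjunct, from the directed one-place letter `hψ_D`.**  See the module docstring.
[cite: KudlaRallis1994, §1] [cite: Folland1989, §4.2 Prop. (4.39)] [cite: Howe1989, §3] [cite: KonnoKonno2007, §3.3, Lemma 5.2] -/
theorem hDXp_directed_of_onePlaceLetter (DX : Matrix (Fin (n + n)) (Fin (n + n)) (mixedSpace L) → Prop) {t : InfinitePlace L → ℤ} (ht : χb.HasUnitaryArchType t 0) (hodd : ∀ w, Odd (t w))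
    (hψ : letI : LieRing (Matrix (Fin 2 ⊕ Fin 2) (Fin 2 ⊕ Fin 2) ℂ) := LieRing.ofAssociativeRing
      ∀ σ : {v : InfinitePlace (Fp L) // v.IsReal}, ∃ ψ : UForm (Fin 2) (Fin 2) →* UnitaryGroup.arch (Fp L) L (IsCMField.complexConj L) (n + n) (hermD L e dV hdV dW hdW),
      (∀ h : UForm (Fin 2) (Fin 2),
        tensorEmb L e dV hdV dW hdW eW e' dV' hdV' (K2LiuArchOneParameterOrbitDefs.archEmb (Fp L) L (IsCMField.complexConj L) (n + n) (hermD L e dV hdV dW hdW) (ψ h)) =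
          K2LiuArchOneParameterOrbitDefs.archEmb (Fp L) L (IsCMField.complexConj L) (n' + n') (hermD L e' dV hdV (tensorFrame L dW eW dV') (tensorFrame_real L dW hdW eW dV' hdV'))
            (placeSecJ L (IsCMField.complexConj L) (n' + n') (IsCMField.complexConj_ne_one L) (cmPlaceOver L) (cmPlaceOver_smul L) _ (gramD_gram_realDiagonal_entry_ne_zero L e' dV hdV (tensorFrame L dW eW dV') (tensorFrame_real L dW hdW eW dV' hdV') hdV0 (tensorFrame_ne_zero L dW eW dV' hdW0 hdV'0)) (complexConj_imagUnit L)
            (imagUnit_ne_zero L) σ (cmPlaceOver_comap L) (gramD_eq_diagonal_cm L e' dV hdV (tensorFrame L dW eW dV') (tensorFrame_real L dW hdW eW dV' hdV')) (J := hermD L e' dV hdV (tensorFrame L dW eW dV') (tensorFrame_real L dW hdW eW dV' hdV')) rfl (complexConj_smul_infinitePlace L) (eP σ) (eQ σ) ((toBig (Fin 2) (Fin 2) (R σ) (S σ) (h, 1), (1 : UForm Unit Empty)) : Ginf ((Fin 2 × R σ) ⊕ (Fin 2 × S σ)) ((Fin 2 × S σ) ⊕ (Fin 2 × R σ)) Unit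 Empty))) ∧
      ∀ Y : ↥(uFormGroup (Fin 2) (Fin 2)).lie.toSubmodule, ∃ (X : Matrix (Fin (n + n)) (Fin (n + n)) (mixedSpace L)) (hX : X ∈ archSkew (Fp L) L (IsCMField.complexConj L) (n + n) (hermD L e dV hdV dW hdW)) (c : ℂ), DX X ∧
        (∀ s : ℝ, K2LiuArchOneParameterOrbitDefs.archExp (Fp L) L (IsCMField.complexConj L) (n + n) (hermD L e dV hdV dW hdW) hX s = K2LiuArchOneParameterOrbitDefs.archEmb (Fp L) L (IsCMField.complexConj L) (n + n) (hermD L e dV hdV dW hdW) (ψ ((uFormGroup (Fin 2) (Fin 2)).expMem ⟨((s • Y : ↥(uFormGroup (Fin 2) (Fin 2)).lie.toSubmodule) : Matrix (Fin 2 ⊕ Fin 2) (Fin 2 ⊕ Fin 2) ℂ), (s • Y).2⟩ : UForm (Fin 2) (Fin 2)))) ∧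
        HasDerivAt (fun t' : ℝ => ((((DoubledWeilDetTwist.detChar L e dV hdV hdV0 dW hdW hdW0 α) (K2LiuArchOneParameterOrbitDefs.archExp (Fp L) L (IsCMField.complexConj L) (n + n) (hermD L e dV hdV dW hdW) hX t')) : ℂˣ) : ℂ)) c 0) :
    ∀ (σ : {v : InfinitePlace (Fp L) // v.IsReal}) (rest : ((τ : {v : InfinitePlace (Fp L) // v.IsReal}) → MvPolynomial (DPIdx (Fin 2) (Fin 2) (R τ) (S τ)) ℂ)) (i : Fin 2 × Fin 2) (F : MvPolynomial (DPIdx (Fin 2) (Fin 2) (R σ) (S σ)) ℂ) (f : FinSB (Fp L) (Fin (n' + n'))),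
      ∃ (X : Matrix (Fin (n + n)) (Fin (n + n)) (mixedSpace L)) (hX : X ∈ archSkew (Fp L) L (IsCMField.complexConj L) (n + n) (hermD L e dV hdV dW hdW))
        (c : ℂ) (G : MvPolynomial (DPIdx (Fin 2) (Fin 2) (R σ) (S σ)) ℂ), DX X ∧ binvPi G = hypOpGenC (R σ) (S σ) i.1 i.2 (binvPi F) ∧
        HasArchDeriv L e dV hdV dW hdW hX (fun h => genFamily L e dV hdV hdV0 dW hdW hdW0 eW e' dV' hdV' hdV'0 χb hχbu hχbs α 𝒦 (piSchwartzBruhatEquiv (Fp L) (Fin (n' + n')) (tupleVec L dV hdV hdV0 dW hdW hdW0 eW e' dV' hdV' hdV'0 R S eP eQ (Function.update rest σ F) ⊗ₜ[ℂ] f)) ((((3 : ℕ) : ℂ) - (n : ℂ)) / 2) h)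
          (fun h => genFamily L e dV hdV hdV0 dW hdW hdW0 eW e' dV' hdV' hdV'0 χb hχbu hχbs α 𝒦 (piSchwartzBruhatEquiv (Fp L) (Fin (n' + n')) (tupleVec L dV hdV hdV0 dW hdW hdW0 eW e' dV' hdV' hdV'0 R S eP eQ (Function.update rest σ (c • F + G)) ⊗ₜ[ℂ] f)) ((((3 : ℕ) : ℂ) - (n : ℂ)) / 2) h) := by
  letI : LieRing (Matrix (Fin 2 ⊕ Fin 2) (Fin 2 ⊕ Fin 2) ℂ) := LieRing.ofAssociativeRing
  intro σ rest i F f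
  obtain ⟨ψ, hsec, hY⟩ := hψ σ
  obtain ⟨X, hX, c, hXD, hcurve, hθ⟩ := hY (⟨boostGen i.1 i.2, boostGen_mem_lie i.1 i.2⟩ : ↥(uFormGroup (Fin 2) (Fin 2)).lie.toSubmodule)
  obtain ⟨G, hG⟩ := exists_fock_hypOpGenC (R σ) (S σ) i.1 i.2 F
  have key := hasArchDeriv_genFamily_fock_of_weakDeriv L e dV hdV hdV0 dW hdW hdW0 eW e' dV' hdV' hdV'0 σ (eP σ) (eQ σ) hX χb hχbu hχbs ht hodd α 𝒦 f ψ hsec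
    (⟨boostGen i.1 i.2, boostGen_mem_lie i.1 i.2⟩ : ↥(uFormGroup (Fin 2) (Fin 2)).lie.toSubmodule) hcurve hθ F G
    (fun T => by rw [hG]; exact hasDerivAt_weilRepPair_expMem_boost i.1 i.2 (binvPi F) T)
    (binvPi (tupleRest (fun τ => unitJunctionIdx ((Fin 2 × R τ) ⊕ (Fin 2 × S τ)) ((Fin 2 × S τ) ⊕ (Fin 2 × R τ))) (frameSlotEquiv L dV hdV dW hdW eW e' dV' hdV' R S eP eQ) σ rest)) (frame_tupleVec_update L dV hdV hdV0 dW hdW hdW0 eW e' dV' hdV' hdV'0 R S eP eQ σ rest F)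
  exact ⟨X, hX, _, G, hXD, hG, key _ (frame_tupleVec_update L dV hdV hdV0 dW hdW hdW0 eW e' dV' hdV' hdV'0 R S eP eQ σ rest _)⟩

include hdW0 hdV'0 in
/-- **(DX⁻) AT THE MODEL, DIRECTED — ★ FILE 2c `good_tupleVec`'s binder `hDXm` BYTES with `DX X ∧` as first conjunct, from the directed one-place letter `hψ_D`.**  See the module docstring.
[cite: KudlaRallis1994, §1] [cite: Folland1989, §4.2 Prop. (4.39)] [cite: Howe1989, §3] [cite: KonnoKonno2007, §3.3, Lemma 5.2] -/
theorem hDXm_directed_of_onePlaceLetter (DX : Matrix (Fin (n + n)) (Fin (n + n)) (mixedSpace L) → Prop) {t : InfinitePlace L → ℤ} (ht : χb.HasUnitaryArchType t 0) (hodd : ∀ w, Odd (t w))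
    (hψ : letI : LieRing (Matrix (Fin 2 ⊕ Fin 2) (Fin 2 ⊕ Fin 2) ℂ) := LieRing.ofAssociativeRing
      ∀ σ : {v : InfinitePlace (Fp L) // v.IsReal}, ∃ ψ : UForm (Fin 2) (Fin 2) →* UnitaryGroup.arch (Fp L) L (IsCMField.complexConj L) (n + n) (hermD L e dV hdV dW hdW),
      (∀ h : UForm (Fin 2) (Fin 2),
        tensorEmb L e dV hdV dW hdW eW e' dV' hdV' (K2LiuArchOneParameterOrbitDefs.archEmb (Fp L) L (IsCMField.complexConj L) (n + n) (hermD L e dV hdV dW hdW) (ψ h)) =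
          K2LiuArchOneParameterOrbitDefs.archEmb (Fp L) L (IsCMField.complexConj L) (n' + n') (hermD L e' dV hdV (tensorFrame L dW eW dV') (tensorFrame_real L dW hdW eW dV' hdV'))
            (placeSecJ L (IsCMField.complexConj L) (n' + n') (IsCMField.complexConj_ne_one L) (cmPlaceOver L) (cmPlaceOver_smul L) _ (gramD_gram_realDiagonal_entry_ne_zero L e' dV hdV (tensorFrame L dW eW dV') (tensorFrame_real L dW hdW eW dV' hdV') hdV0 (tensorFrame_ne_zero L dW eW dV' hdW0 hdV'0)) (complexConj_imagUnit L)
            (imagUnit_ne_zero L) σ (cmPlaceOver_comap L) (gramD_eq_diagonal_cm L e' dV hdV (tensorFrame L dW eW dV') (tensorFrame_real L dW hdW eW dV' hdV')) (J := hermD L e' dV hdV (tensorFrame L dW eW dV') (tensorFrame_real L dW hdW eW dV' hdV')) rfl (complexConj_smul_infinitePlace L) (eP σ) (eQ σ) ((toBig (Fin 2) (Fin 2) (R σ) (S σ) (h, 1), (1 : UForm Unit Empty)) : Ginf ((Fin 2 × R σ) ⊕ (Fin 2 × S σ)) ((Fin 2 × S σ) ⊕ (Fin 2 × R σ)) Unit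 Empty))) ∧
      ∀ Y : ↥(uFormGroup (Fin 2) (Fin 2)).lie.toSubmodule, ∃ (X : Matrix (Fin (n + n)) (Fin (n + n)) (mixedSpace L)) (hX : X ∈ archSkew (Fp L) L (IsCMField.complexConj L) (n + n) (hermD L e dV hdV dW hdW)) (c : ℂ), DX X ∧
        (∀ s : ℝ, K2LiuArchOneParameterOrbitDefs.archExp (Fp L) L (IsCMField.complexConj L) (n + n) (hermD L e dV hdV dW hdW) hX s = K2LiuArchOneParameterOrbitDefs.archEmb (Fp L) L (IsCMField.complexConj L) (n + n) (hermD L e dV hdV dW hdW) (ψ ((uFormGroup (Fin 2) (Fin 2)).expMem ⟨((s • Y : ↥(uFormGroup (Fin 2) (Fin 2)).lie.toSubmodule) : Matrix (Fin 2 ⊕ Fin 2) (Fin 2 ⊕ Fin 2) ℂ), (s • Y).2⟩ : UForm (Fin 2) (Fin 2)))) ∧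
        HasDerivAt (fun t' : ℝ => ((((DoubledWeilDetTwist.detChar L e dV hdV hdV0 dW hdW hdW0 α) (K2LiuArchOneParameterOrbitDefs.archExp (Fp L) L (IsCMField.complexConj L) (n + n) (hermD L e dV hdV dW hdW) hX t')) : ℂˣ) : ℂ)) c 0) :
    ∀ (σ : {v : InfinitePlace (Fp L) // v.IsReal}) (rest : ((τ : {v : InfinitePlace (Fp L) // v.IsReal}) → MvPolynomial (DPIdx (Fin 2) (Fin 2) (R τ) (S τ)) ℂ)) (i : Fin 2 × Fin 2) (F : MvPolynomial (DPIdx (Fin 2) (Fin 2) (R σ) (S σ)) ℂ) (f : FinSB (Fp L) (Fin (n' + n'))),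
      ∃ (X : Matrix (Fin (n + n)) (Fin (n + n)) (mixedSpace L)) (hX : X ∈ archSkew (Fp L) L (IsCMField.complexConj L) (n + n) (hermD L e dV hdV dW hdW))
        (c : ℂ) (G : MvPolynomial (DPIdx (Fin 2) (Fin 2) (R σ) (S σ)) ℂ), DX X ∧ binvPi G = unitaryOpPi (phaseU (R σ) (S σ) i.1 (π / 2)) (hypOpGenC (R σ) (S σ) i.1 i.2 (unitaryOpPi (phaseU (R σ) (S σ) i.1 (π / 2))⁻¹ (binvPi F))) ∧
        HasArchDeriv L e dV hdV dW hdW hX (fun h => genFamily L e dV hdV hdV0 dW hdW hdW0 eW e' dV' hdV' hdV'0 χb hχbu hχbs α 𝒦 (piSchwartzBruhatEquiv (Fp L) (Fin (n' + n')) (tupleVec L dV hdV hdV0 dW hdW hdW0 eW e' dV' hdV' hdV'0 R S eP eQ (Function.update rest σ F) ⊗ₜ[ℂ] f)) ((((3 : ℕ) : ℂ) - (n : ℂ)) / 2) h)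
          (fun h => genFamily L e dV hdV hdV0 dW hdW hdW0 eW e' dV' hdV' hdV'0 χb hχbu hχbs α 𝒦 (piSchwartzBruhatEquiv (Fp L) (Fin (n' + n')) (tupleVec L dV hdV hdV0 dW hdW hdW0 eW e' dV' hdV' hdV'0 R S eP eQ (Function.update rest σ (c • F + G)) ⊗ₜ[ℂ] f)) ((((3 : ℕ) : ℂ) - (n : ℂ)) / 2) h) := by
  letI : LieRing (Matrix (Fin 2 ⊕ Fin 2) (Fin 2 ⊕ Fin 2) ℂ) := LieRing.ofAssociativeRing
  intro σ rest i F f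
  obtain ⟨ψ, hsec, hY⟩ := hψ σ
  obtain ⟨X, hX, c, hXD, hcurve, hθ⟩ := hY (⟨((UForm.kV (Fin 2) (Fin 2) (phaseP (R σ) (S σ) i.1 (π / 2)).1 : GL (Fin 2 ⊕ Fin 2) ℂ) : Matrix (Fin 2 ⊕ Fin 2) (Fin 2 ⊕ Fin 2) ℂ) * boostGen i.1 i.2 * (((UForm.kV (Fin 2) (Fin 2) (phaseP (R σ) (S σ) i.1 (π / 2)).1 : GL (Fin 2 ⊕ Fin 2) ℂ)⁻¹ : GL (Fin 2 ⊕ Fin 2) ℂ) : Matrix (Fin 2 ⊕ Fin 2) (Fin 2 ⊕ Fin 2) ℂ), (uFormGroup (Fin 2) (Fin 2)).conj_mem_lie _ (UForm.kV (Fin 2) (Fin 2) (phaseP (R σ) (S σ) i.1 (π / 2)).1).2 _ (boostGen_mem_lie i.1 i.2)⟩ : ↥(uFormGroup (Fin 2) (Fin 2)).lie.toSubmodule)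
  obtain ⟨G, hG⟩ := exists_fock_rotBoostGen (R σ) (S σ) i.1 i.2 (π / 2) F
  have key := hasArchDeriv_genFamily_fock_of_weakDeriv L e dV hdV hdV0 dW hdW hdW0 eW e' dV' hdV' hdV'0 σ (eP σ) (eQ σ) hX χb hχbu hχbs ht hodd α 𝒦 f ψ hsec
    (⟨((UForm.kV (Fin 2) (Fin 2) (phaseP (R σ) (S σ) i.1 (π / 2)).1 : GL (Fin 2 ⊕ Fin 2) ℂ) : Matrix (Fin 2 ⊕ Fin 2) (Fin 2 ⊕ Fin 2) ℂ) * boostGen i.1 i.2 * (((UForm.kV (Fin 2) (Fin 2) (phaseP (R σ) (S σ) i.1 (π / 2)).1 : GL (Fin 2 ⊕ Fin 2) ℂ)⁻¹ : GL (Fin 2 ⊕ Fin 2) ℂ) : Matrix (Fin 2 ⊕ Fin 2) (Fin 2 ⊕ Fin 2) ℂ), (uFormGroup (Fin 2) (Fin 2)).conj_mem_lie _ (UForm.kV (Fin 2) (Fin 2) (phaseP (R σ) (S σ) i.1 (π / 2)).1).2 _ (boostGen_mem_lie i.1 i.2)⟩ : ↥(uFormGroup (Fin 2) (Fin 2)).lie.toSubmodule)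 hcurve hθ F G
    (fun T => by rw [hG]; exact hasDerivAt_weilRepPair_expMem_conj_boost i.1 i.2 (π / 2) (binvPi F) T)
    (binvPi (tupleRest (fun τ => unitJunctionIdx ((Fin 2 × R τ) ⊕ (Fin 2 × S τ)) ((Fin 2 × S τ) ⊕ (Fin 2 × R τ))) (frameSlotEquiv L dV hdV dW hdW eW e' dV' hdV' R S eP eQ) σ rest)) (frame_tupleVec_update L dV hdV hdV0 dW hdW hdW0 eW e' dV' hdV' hdV'0 R S eP eQ σ rest F)
  exact ⟨X, hX, _, G, hXD, hG, key _ (frame_tupleVec_update L dV hdV hdV0 dW hdW hdW0 eW e' dV' hdV' hdV'0 R S eP eQ σ rest _)⟩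


end FaceG

/-! ## §2 The directed one-place letter at the junction frames of record (generic shapes) -/

section Generic

variable (L : Type) [Field L] [NumberField L] [IsCMField L]
variable {N M n : ℕ} (e : Fin N × Fin M ≃ Fin n)
  (dV : Fin N → L) (hdV : ∀ i, IsCMField.complexConj L (dV i) = dV i) (hdV0 : ∀ i, dV i ≠ 0)
  (dW : Fin M → L) (hdW : ∀ i, IsCMField.complexConj L (dW i) = dW i) (hdW0 : ∀ i, dW i ≠ 0)
variable {M₂ M' n' : ℕ} (eW : Fin M × Fin M₂ ≃ Fin M') (e' : Fin N × Fin M' ≃ Fin n')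
  (dV' : Fin M₂ → L) (hdV' : ∀ k, IsCMField.complexConj L (dV' k) = dV' k) (hdV'0 : ∀ k, dV' k ≠ 0)
  (α : UnitaryGroup.adelicOne (Fp L) L (IsCMField.complexConj L) →* ℂˣ)

include hdV0 hdW0 hdV'0 in
/-- **THE DIRECTED ONE-PLACE LETTER `hψ_D` AT THE JUNCTION FRAMES OF RECORD, under the letter `hDX` «`DX` sees the chart images at the junction frames».**  See the module docstring.
[cite: KonnoKonno2007, §3.1 (3.1)] [cite: Kudla1994, §2] [cite: BorelJacquet1979, §4.1] [cite: Varadarajan1984, Thm. 2.10.1, Thm. 2.11.2] [cite: GelbartRogawski1991, §3.1 Remark p. 457] -/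
theorem onePlaceLetter_directed_of_junctionFrames (DX : Matrix (Fin (n + n)) (Fin (n + n)) (mixedSpace L) → Prop) (hα : Continuous α)
    (y : {v : InfinitePlace (Fp L) // v.IsReal} → Fin M₂ → ℝ) (hy : ∀ σ k, y σ k ≠ 0)
    (hz : ∀ (σ : {v : InfinitePlace (Fp L) // v.IsReal}) j, (signVec (cmPlaceOver L) (fun k => Sum.elim (cmGramEntry L e' dV hdV (tensorFrame L dW eW dV') (tensorFrame_real L dW hdW eW dV' hdV')) (-cmGramEntry L e' dV hdV (tensorFrame L dW eW dV') (tensorFrame_real L dW hdW eW dV' hdV')) ((LocalSplitting.e₂ n').symm k)) (imagUnit L) σ) j = (signVec (cmPlaceOver L) (fun k => Sum.elim (cmGramEntry L e dV hdV dW hdW) (-cmGramEntry L e dV hdV dW hdW) ((LocalSplitting.e₂ n).symm k)) (imagUnit L) σ) ((epsD e eW e').symm j).1 * y σ ((epsD e eW e').symm j).2)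
    (eP₀ : ∀ σ : {v : InfinitePlace (Fp L) // v.IsReal}, (PosIdx (signVec (cmPlaceOver L) (fun k => Sum.elim (cmGramEntry L e dV hdV dW hdW) (-cmGramEntry L e dV hdV dW hdW) ((LocalSplitting.e₂ n).symm k)) (imagUnit L) σ) × PosIdx (y σ)) ⊕ (NegIdx (signVec (cmPlaceOver L) (fun k => Sum.elim (cmGramEntry L e dV hdV dW hdW) (-cmGramEntry L e dV hdV dW hdW) ((LocalSplitting.e₂ n).symm k)) (imagUnit L) σ) × NegIdx (y σ)) ≃ PosIdx (signVec (cmPlaceOver L) (fun k => Sum.elim (cmGramEntry L e' dV hdV (tensorFrame L dW eW dV') (tensorFrame_real L dW hdW eW dV' hdV')) (-cmGramEntry L e' dV hdV (tensorFrame L dW eW dV') (tensorFrame_real L dW hdW eW dV' hdV')) ((LocalSplitting.e₂ n').symm k)) (imagUnit L) σ))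
    (eQ₀ : ∀ σ : {v : InfinitePlace (Fp L) // v.IsReal}, (PosIdx (signVec (cmPlaceOver L) (fun k => Sum.elim (cmGramEntry L e dV hdV dW hdW) (-cmGramEntry L e dV hdV dW hdW) ((LocalSplitting.e₂ n).symm k)) (imagUnit L) σ) × NegIdx (y σ)) ⊕ (NegIdx (signVec (cmPlaceOver L) (fun k => Sum.elim (cmGramEntry L e dV hdV dW hdW) (-cmGramEntry L e dV hdV dW hdW) ((LocalSplitting.e₂ n).symm k)) (imagUnit L) σ) × PosIdx (y σ)) ≃ NegIdx (signVec (cmPlaceOver L) (fun k => Sum.elim (cmGramEntry L e' dV hdV (tensorFrame L dW eW dV') (tensorFrame_real L dW hdW eW dV' hdV')) (-cmGramEntry L e' dV hdV (tensorFrame L dW eW dV') (tensorFrame_real L dW hdW eW dV' hdV')) ((LocalSplitting.e₂ n').symm k)) (imagUnit L) σ))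
    (hE : ∀ (σ : {v : InfinitePlace (Fp L) // v.IsReal}) i, (dpEquiv _ _ _ _).symm (((eP₀ σ).sumCongr (eQ₀ σ)).symm i) =
      (signSplit (signVec (cmPlaceOver L) (fun k => Sum.elim (cmGramEntry L e dV hdV dW hdW) (-cmGramEntry L e dV hdV dW hdW) ((LocalSplitting.e₂ n).symm k)) (imagUnit L) σ) ((epsD e eW e').symm ((signSplit (signVec (cmPlaceOver L) (fun k => Sum.elim (cmGramEntry L e' dV hdV (tensorFrame L dW eW dV') (tensorFrame_real L dW hdW eW dV' hdV')) (-cmGramEntry L e' dV hdV (tensorFrame L dW eW dV') (tensorFrame_real L dW hdW eW dV' hdV')) ((LocalSplitting.e₂ n').symm k)) (imagUnit L) σ)).symm i)).1, signSplit (y σ) ((epsD e eW e').symm ((signSplit (signVec (cmPlaceOver L) (fun k => Sum.elim (cmGramEntry L e' dV hdV (tensorFrame L dW eW dV') (tensorFrame_real L dW hdW eW dV' hdV')) (-cmGramEntry L e' dV hdV (tensorFrame L dW eW dV') (tensorFrame_real L dW hdW eW dV' hdV')) ((LocalSplitting.e₂ n').symm k)) (imagUnit L) σ)).symm i)).2)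)
    (eSp : ∀ σ : {v : InfinitePlace (Fp L) // v.IsReal}, Fin 2 ≃ PosIdx (signVec (cmPlaceOver L) (fun k => Sum.elim (cmGramEntry L e dV hdV dW hdW) (-cmGramEntry L e dV hdV dW hdW) ((LocalSplitting.e₂ n).symm k)) (imagUnit L) σ)) (eSq : ∀ σ : {v : InfinitePlace (Fp L) // v.IsReal}, Fin 2 ≃ NegIdx (signVec (cmPlaceOver L) (fun k => Sum.elim (cmGramEntry L e dV hdV dW hdW) (-cmGramEntry L e dV hdV dW hdW) ((LocalSplitting.e₂ n).symm k)) (imagUnit L) σ))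
    (hDX : letI : LieRing (Matrix (Fin 2 ⊕ Fin 2) (Fin 2 ⊕ Fin 2) ℂ) := LieRing.ofAssociativeRing
      ∀ (σ : {v : InfinitePlace (Fp L) // v.IsReal}) (Y : ↥(uFormGroup (Fin 2) (Fin 2)).lie.toSubmodule) (X : Matrix (Fin (n + n)) (Fin (n + n)) (mixedSpace L)) (hX : X ∈ archSkew (Fp L) L (IsCMField.complexConj L) (n + n) (hermD L e dV hdV dW hdW)),
      (∀ s : ℝ, K2LiuArchOneParameterOrbitDefs.archExp (Fp L) L (IsCMField.complexConj L) (n + n) (hermD L e dV hdV dW hdW) hX s =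
        K2LiuArchOneParameterOrbitDefs.archEmb (Fp L) L (IsCMField.complexConj L) (n + n) (hermD L e dV hdV dW hdW)
          (placeSecJ L (IsCMField.complexConj L) (n + n) (IsCMField.complexConj_ne_one L) (cmPlaceOver L) (cmPlaceOver_smul L) _
            (gramD_gram_realDiagonal_entry_ne_zero L e dV hdV dW hdW hdV0 hdW0) (complexConj_imagUnit L) (imagUnit_ne_zero L) σ
            (cmPlaceOver_comap L) (gramD_eq_diagonal_cm L e dV hdV dW hdW) (J := hermD L e dV hdV dW hdW) rfl
            (complexConj_smul_infinitePlace L) (eSp σ).symm (eSq σ).symm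
            ((((uFormGroup (Fin 2) (Fin 2)).expMem
                ⟨((s • Y : ↥(uFormGroup (Fin 2) (Fin 2)).lie.toSubmodule) : Matrix (Fin 2 ⊕ Fin 2) (Fin 2 ⊕ Fin 2) ℂ), (s • Y).2⟩ :
                UForm (Fin 2) (Fin 2)), (1 : UForm Unit Empty)) : Ginf (Fin 2) (Fin 2) Unit Empty))) → DX X) :
    letI : LieRing (Matrix (Fin 2 ⊕ Fin 2) (Fin 2 ⊕ Fin 2) ℂ) := LieRing.ofAssociativeRing
    ∀ σ : {v : InfinitePlace (Fp L) // v.IsReal}, ∃ ψ : UForm (Fin 2) (Fin 2) →* UnitaryGroup.arch (Fp L) L (IsCMField.complexConj L) (n + n) (hermD L e dV hdV dW hdW),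
      (∀ h : UForm (Fin 2) (Fin 2),
        tensorEmb L e dV hdV dW hdW eW e' dV' hdV' (K2LiuArchOneParameterOrbitDefs.archEmb (Fp L) L (IsCMField.complexConj L) (n + n) (hermD L e dV hdV dW hdW) (ψ h)) =
          K2LiuArchOneParameterOrbitDefs.archEmb (Fp L) L (IsCMField.complexConj L) (n' + n') (hermD L e' dV hdV (tensorFrame L dW eW dV') (tensorFrame_real L dW hdW eW dV' hdV'))
            ((placeSecJ L (IsCMField.complexConj L) (n' + n') (IsCMField.complexConj_ne_one L) (cmPlaceOver L) (cmPlaceOver_smul L) _ (gramD_gram_realDiagonal_entry_ne_zero L e' dV hdV (tensorFrame L dW eW dV') (tensorFrame_real L dW hdW eW dV' hdV') hdV0 (tensorFrame_ne_zero L dW eW dV' hdW0 hdV'0)) (complexConj_imagUnit L)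
            (imagUnit_ne_zero L) σ (cmPlaceOver_comap L) (gramD_eq_diagonal_cm L e' dV hdV (tensorFrame L dW eW dV') (tensorFrame_real L dW hdW eW dV' hdV')) (J := hermD L e' dV hdV (tensorFrame L dW eW dV') (tensorFrame_real L dW hdW eW dV' hdV')) rfl (complexConj_smul_infinitePlace L)
            ((eP₀ σ).symm.trans (Equiv.sumCongr ((eSp σ).symm.prodCongr (Equiv.refl (PosIdx (y σ)))) ((eSq σ).symm.prodCongr (Equiv.refl (NegIdx (y σ)))))) ((eQ₀ σ).symm.trans (Equiv.sumCongr ((eSp σ).symm.prodCongr (Equiv.refl (NegIdx (y σ)))) ((eSq σ).symm.prodCongr (Equiv.refl (PosIdx (y σ))))))) ((toBig (Fin 2) (Fin 2) (PosIdx (y σ)) (NegIdx (y σ)) (h, 1), (1 : UForm Unit Empty)) : Ginf ((Fin 2 × PosIdx (y σ)) ⊕ (Fin 2 × NegIdx (y σ))) ((Fin 2 × NegIdx (y σ)) ⊕ (Fin 2 × PosIdx (y σ))) Unit Empty))) ∧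
      ∀ Y : ↥(uFormGroup (Fin 2) (Fin 2)).lie.toSubmodule, ∃ (X : Matrix (Fin (n + n)) (Fin (n + n)) (mixedSpace L)) (hX : X ∈ archSkew (Fp L) L (IsCMField.complexConj L) (n + n) (hermD L e dV hdV dW hdW)) (c : ℂ), DX X ∧
        (∀ s : ℝ, K2LiuArchOneParameterOrbitDefs.archExp (Fp L) L (IsCMField.complexConj L) (n + n) (hermD L e dV hdV dW hdW) hX s = K2LiuArchOneParameterOrbitDefs.archEmb (Fp L) L (IsCMField.complexConj L) (n + n) (hermD L e dV hdV dW hdW) (ψ ((uFormGroup (Fin 2) (Fin 2)).expMem ⟨((s • Y : ↥(uFormGroup (Fin 2) (Fin 2)).lie.toSubmodule) : Matrix (Fin 2 ⊕ Fin 2) (Fin 2 ⊕ Fin 2) ℂ), (s • Y).2⟩ : UForm (Fin 2) (Fin 2)))) ∧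
        HasDerivAt (fun t' : ℝ => ((((DoubledWeilDetTwist.detChar L e dV hdV hdV0 dW hdW hdW0 α) (K2LiuArchOneParameterOrbitDefs.archExp (Fp L) L (IsCMField.complexConj L) (n + n) (hermD L e dV hdV dW hdW) hX t')) : ℂˣ) : ℂ)) c 0 := by
  letI : LieRing (Matrix (Fin 2 ⊕ Fin 2) (Fin 2 ⊕ Fin 2) ℂ) := LieRing.ofAssociativeRing
  intro σ
  refine ⟨((placeSec L (IsCMField.complexConj L) (n + n) (IsCMField.complexConj_ne_one L) (cmPlaceOver L) (cmPlaceOver_smul L) _ (gramD_gram_realDiagonal_entry_ne_zero L e dV hdV dW hdW hdV0 hdW0) (complexConj_imagUnit L) (imagUnit_ne_zero L) σ (cmPlaceOver_comap L) (gramD_eq_diagonal_cm L e dV hdV dW hdW) (J := hermD L e dV hdV dW hdW) rfl (complexConj_smul_infinitePlace L)).comp (UForm.relabel (Fin 2) (Fin 2) (PosIdx (signVec (cmPlaceOver L) (fun k => Sum.elim (cmGramEntry L e dV hdV dW hdW) (-cmGramEntry L e dV hdV dW hdW) ((LocalSplitting.e₂ n).symm k)) (imagUnit L) σ)) (NegIdx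 (signVec (cmPlaceOver L) (fun k => Sum.elim (cmGramEntry L e dV hdV dW hdW) (-cmGramEntry L e dV hdV dW hdW) ((LocalSplitting.e₂ n).symm k)) (imagUnit L) σ)) (eSp σ) (eSq σ)).toMonoidHom), hsec_placeSec_relabel L e dV hdV hdV0 dW hdW hdW0 eW e' dV' hdV' hdV'0 σ (y σ) (hy σ) (hz σ) (eP₀ σ) (eQ₀ σ) (hE σ) (eSp σ) (eSq σ), fun Y => ?_⟩
  obtain ⟨X, hX, hcurve, -⟩ := exists_archSkew_archExp_eq_placeSecJ_expMem L e dV hdV hdV0 dW hdW hdW0 σ (eSp σ).symm (eSq σ).symm Y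
  refine ⟨X, hX, _, hDX σ Y X hX hcurve, fun s => ?_, hasDerivAt_coe_detChar_archExp L e dV hdV hdV0 dW hdW hdW0 σ (eSp σ).symm (eSq σ).symm Y hX hcurve α hα⟩
  rw [hcurve s, placeSecJ_inl, MonoidHom.comp_apply, relabel_symm_symm_apply]
  rfl


end Generic

/-! ## §3 The directed one-place letter under the single-place-aware letter `hDX` (edition 2; box K2E5-r02 junction J2, exit (E1)) -/

section GenericSinglePlace

variable (L : Type) [Field L] [NumberField L] [IsCMField L]
variable {N M n : ℕ} (e : Fin N × Fin M ≃ Fin n)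
  (dV : Fin N → L) (hdV : ∀ i, IsCMField.complexConj L (dV i) = dV i) (hdV0 : ∀ i, dV i ≠ 0)
  (dW : Fin M → L) (hdW : ∀ i, IsCMField.complexConj L (dW i) = dW i) (hdW0 : ∀ i, dW i ≠ 0)
variable {M₂ M' n' : ℕ} (eW : Fin M × Fin M₂ ≃ Fin M') (e' : Fin N × Fin M' ≃ Fin n')
  (dV' : Fin M₂ → L) (hdV' : ∀ k, IsCMField.complexConj L (dV' k) = dV' k) (hdV'0 : ∀ k, dV' k ≠ 0)
  (α : UnitaryGroup.adelicOne (Fp L) L (IsCMField.complexConj L) →* ℂˣ)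

include hdV0 hdW0 hdV'0 in
/-- **THE DIRECTED ONE-PLACE LETTER `hψ_D` AT THE JUNCTION FRAMES OF RECORD, under the SINGLE-PLACE-AWARE letter `hDX`**: as §2 `onePlaceLetter_directed_of_junctionFrames`,
but the letter `hDX` receives BOTH conjuncts of ★ `exists_archSkew_archExp_eq_placeSecJ_expMem … σ (eSp σ)⁻¹ (eSq σ)⁻¹ Y` about the witness `X` — the chart-curve identity AND
the single-place support `∀ w ≠ cmPlaceOver L σ, X.map (evalC L w) = 0` — so that at the SINGLE-PLACE direction predicate of record (`DX X := ∃ w₀, ∀ w ≠ w₀, X.map (evalC L w) = 0`)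
it is discharged by `fun σ Y X hX _ hw => ⟨cmPlaceOver L σ, hw⟩` (box K2E5-r02 (g7) junction J2, exit (E1), 2026-09-05T00:52:10Z).  See the module docstring.
[cite: KonnoKonno2007, §3.1 (3.1)] [cite: Kudla1994, §2] [cite: BorelJacquet1979, §4.1] [cite: Varadarajan1984, Thm. 2.10.1, Thm. 2.11.2] [cite: GelbartRogawski1991, §3.1 Remark p. 457] -/
theorem onePlaceLetter_directed_of_junctionFrames' (DX : Matrix (Fin (n + n)) (Fin (n + n)) (mixedSpace L) → Prop) (hα : Continuous α)
    (y : {v : InfinitePlace (Fp L) // v.IsReal} → Fin M₂ → ℝ) (hy : ∀ σ k, y σ k ≠ 0)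
    (hz : ∀ (σ : {v : InfinitePlace (Fp L) // v.IsReal}) j, (signVec (cmPlaceOver L) (fun k => Sum.elim (cmGramEntry L e' dV hdV (tensorFrame L dW eW dV') (tensorFrame_real L dW hdW eW dV' hdV')) (-cmGramEntry L e' dV hdV (tensorFrame L dW eW dV') (tensorFrame_real L dW hdW eW dV' hdV')) ((LocalSplitting.e₂ n').symm k)) (imagUnit L) σ) j = (signVec (cmPlaceOver L) (fun k => Sum.elim (cmGramEntry L e dV hdV dW hdW) (-cmGramEntry L e dV hdV dW hdW) ((LocalSplitting.e₂ n).symm k)) (imagUnit L) σ) ((epsD e eW e').symm j).1 * y σ ((epsD e eW e').symm j).2)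
    (eP₀ : ∀ σ : {v : InfinitePlace (Fp L) // v.IsReal}, (PosIdx (signVec (cmPlaceOver L) (fun k => Sum.elim (cmGramEntry L e dV hdV dW hdW) (-cmGramEntry L e dV hdV dW hdW) ((LocalSplitting.e₂ n).symm k)) (imagUnit L) σ) × PosIdx (y σ)) ⊕ (NegIdx (signVec (cmPlaceOver L) (fun k => Sum.elim (cmGramEntry L e dV hdV dW hdW) (-cmGramEntry L e dV hdV dW hdW) ((LocalSplitting.e₂ n).symm k)) (imagUnit L) σ) × NegIdx (y σ)) ≃ PosIdx (signVec (cmPlaceOver L) (fun k => Sum.elim (cmGramEntry L e' dV hdV (tensorFrame L dW eW dV') (tensorFrame_real L dW hdW eW dV' hdV')) (-cmGramEntry L e' dV hdV (tensorFrame L dW eW dV') (tensorFrame_real L dW hdW eW dV' hdV')) ((LocalSplitting.e₂ n').symm k)) (imagUnit L) σ))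
    (eQ₀ : ∀ σ : {v : InfinitePlace (Fp L) // v.IsReal}, (PosIdx (signVec (cmPlaceOver L) (fun k => Sum.elim (cmGramEntry L e dV hdV dW hdW) (-cmGramEntry L e dV hdV dW hdW) ((LocalSplitting.e₂ n).symm k)) (imagUnit L) σ) × NegIdx (y σ)) ⊕ (NegIdx (signVec (cmPlaceOver L) (fun k => Sum.elim (cmGramEntry L e dV hdV dW hdW) (-cmGramEntry L e dV hdV dW hdW) ((LocalSplitting.e₂ n).symm k)) (imagUnit L) σ) × PosIdx (y σ)) ≃ NegIdx (signVec (cmPlaceOver L) (fun k => Sum.elim (cmGramEntry L e' dV hdV (tensorFrame L dW eW dV') (tensorFrame_real L dW hdW eW dV' hdV')) (-cmGramEntry L e' dV hdV (tensorFrame L dW eW dV') (tensorFrame_real L dW hdW eW dV' hdV')) ((LocalSplitting.e₂ n').symm k)) (imagUnit L) σ))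
    (hE : ∀ (σ : {v : InfinitePlace (Fp L) // v.IsReal}) i, (dpEquiv _ _ _ _).symm (((eP₀ σ).sumCongr (eQ₀ σ)).symm i) =
      (signSplit (signVec (cmPlaceOver L) (fun k => Sum.elim (cmGramEntry L e dV hdV dW hdW) (-cmGramEntry L e dV hdV dW hdW) ((LocalSplitting.e₂ n).symm k)) (imagUnit L) σ) ((epsD e eW e').symm ((signSplit (signVec (cmPlaceOver L) (fun k => Sum.elim (cmGramEntry L e' dV hdV (tensorFrame L dW eW dV') (tensorFrame_real L dW hdW eW dV' hdV')) (-cmGramEntry L e' dV hdV (tensorFrame L dW eW dV') (tensorFrame_real L dW hdW eW dV' hdV')) ((LocalSplitting.e₂ n').symm k)) (imagUnit L) σ)).symm i)).1, signSplit (y σ) ((epsD e eW e').symm ((signSplit (signVec (cmPlaceOver L) (fun k => Sum.elim (cmGramEntry L e' dV hdV (tensorFrame L dW eW dV') (tensorFrame_real L dW hdW eW dV' hdV')) (-cmGramEntry L e' dV hdV (tensorFrame L dW eW dV') (tensorFrame_real L dW hdW eW dV' hdV')) ((LocalSplitting.e₂ n').symm k)) (imagUnit L) σ)).symm i)).2)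)
    (eSp : ∀ σ : {v : InfinitePlace (Fp L) // v.IsReal}, Fin 2 ≃ PosIdx (signVec (cmPlaceOver L) (fun k => Sum.elim (cmGramEntry L e dV hdV dW hdW) (-cmGramEntry L e dV hdV dW hdW) ((LocalSplitting.e₂ n).symm k)) (imagUnit L) σ)) (eSq : ∀ σ : {v : InfinitePlace (Fp L) // v.IsReal}, Fin 2 ≃ NegIdx (signVec (cmPlaceOver L) (fun k => Sum.elim (cmGramEntry L e dV hdV dW hdW) (-cmGramEntry L e dV hdV dW hdW) ((LocalSplitting.e₂ n).symm k)) (imagUnit L) σ))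
    (hDX : letI : LieRing (Matrix (Fin 2 ⊕ Fin 2) (Fin 2 ⊕ Fin 2) ℂ) := LieRing.ofAssociativeRing
      ∀ (σ : {v : InfinitePlace (Fp L) // v.IsReal}) (Y : ↥(uFormGroup (Fin 2) (Fin 2)).lie.toSubmodule) (X : Matrix (Fin (n + n)) (Fin (n + n)) (mixedSpace L)) (hX : X ∈ archSkew (Fp L) L (IsCMField.complexConj L) (n + n) (hermD L e dV hdV dW hdW)),
      (∀ s : ℝ, K2LiuArchOneParameterOrbitDefs.archExp (Fp L) L (IsCMField.complexConj L) (n + n) (hermD L e dV hdV dW hdW) hX s =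
        K2LiuArchOneParameterOrbitDefs.archEmb (Fp L) L (IsCMField.complexConj L) (n + n) (hermD L e dV hdV dW hdW)
          (placeSecJ L (IsCMField.complexConj L) (n + n) (IsCMField.complexConj_ne_one L) (cmPlaceOver L) (cmPlaceOver_smul L) _
            (gramD_gram_realDiagonal_entry_ne_zero L e dV hdV dW hdW hdV0 hdW0) (complexConj_imagUnit L) (imagUnit_ne_zero L) σ
            (cmPlaceOver_comap L) (gramD_eq_diagonal_cm L e dV hdV dW hdW) (J := hermD L e dV hdV dW hdW) rfl
            (complexConj_smul_infinitePlace L) (eSp σ).symm (eSq σ).symm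
            ((((uFormGroup (Fin 2) (Fin 2)).expMem
                ⟨((s • Y : ↥(uFormGroup (Fin 2) (Fin 2)).lie.toSubmodule) : Matrix (Fin 2 ⊕ Fin 2) (Fin 2 ⊕ Fin 2) ℂ), (s • Y).2⟩ :
                UForm (Fin 2) (Fin 2)), (1 : UForm Unit Empty)) : Ginf (Fin 2) (Fin 2) Unit Empty))) →
      (∀ w : {w : InfinitePlace L // w.IsComplex}, w ≠ cmPlaceOver L σ → X.map (evalC L w) = 0) → DX X) :
    letI : LieRing (Matrix (Fin 2 ⊕ Fin 2) (Fin 2 ⊕ Fin 2) ℂ) := LieRing.ofAssociativeRing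
    ∀ σ : {v : InfinitePlace (Fp L) // v.IsReal}, ∃ ψ : UForm (Fin 2) (Fin 2) →* UnitaryGroup.arch (Fp L) L (IsCMField.complexConj L) (n + n) (hermD L e dV hdV dW hdW),
      (∀ h : UForm (Fin 2) (Fin 2),
        tensorEmb L e dV hdV dW hdW eW e' dV' hdV' (K2LiuArchOneParameterOrbitDefs.archEmb (Fp L) L (IsCMField.complexConj L) (n + n) (hermD L e dV hdV dW hdW) (ψ h)) =
          K2LiuArchOneParameterOrbitDefs.archEmb (Fp L) L (IsCMField.complexConj L) (n' + n') (hermD L e' dV hdV (tensorFrame L dW eW dV') (tensorFrame_real L dW hdW eW dV' hdV'))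
            ((placeSecJ L (IsCMField.complexConj L) (n' + n') (IsCMField.complexConj_ne_one L) (cmPlaceOver L) (cmPlaceOver_smul L) _ (gramD_gram_realDiagonal_entry_ne_zero L e' dV hdV (tensorFrame L dW eW dV') (tensorFrame_real L dW hdW eW dV' hdV') hdV0 (tensorFrame_ne_zero L dW eW dV' hdW0 hdV'0)) (complexConj_imagUnit L)
            (imagUnit_ne_zero L) σ (cmPlaceOver_comap L) (gramD_eq_diagonal_cm L e' dV hdV (tensorFrame L dW eW dV') (tensorFrame_real L dW hdW eW dV' hdV')) (J := hermD L e' dV hdV (tensorFrame L dW eW dV') (tensorFrame_real L dW hdW eW dV' hdV')) rfl (complexConj_smul_infinitePlace L)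
            ((eP₀ σ).symm.trans (Equiv.sumCongr ((eSp σ).symm.prodCongr (Equiv.refl (PosIdx (y σ)))) ((eSq σ).symm.prodCongr (Equiv.refl (NegIdx (y σ)))))) ((eQ₀ σ).symm.trans (Equiv.sumCongr ((eSp σ).symm.prodCongr (Equiv.refl (NegIdx (y σ)))) ((eSq σ).symm.prodCongr (Equiv.refl (PosIdx (y σ))))))) ((toBig (Fin 2) (Fin 2) (PosIdx (y σ)) (NegIdx (y σ)) (h, 1), (1 : UForm Unit Empty)) : Ginf ((Fin 2 × PosIdx (y σ)) ⊕ (Fin 2 × NegIdx (y σ))) ((Fin 2 × NegIdx (y σ)) ⊕ (Fin 2 × PosIdx (y σ))) Unit Empty))) ∧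
      ∀ Y : ↥(uFormGroup (Fin 2) (Fin 2)).lie.toSubmodule, ∃ (X : Matrix (Fin (n + n)) (Fin (n + n)) (mixedSpace L)) (hX : X ∈ archSkew (Fp L) L (IsCMField.complexConj L) (n + n) (hermD L e dV hdV dW hdW)) (c : ℂ), DX X ∧
        (∀ s : ℝ, K2LiuArchOneParameterOrbitDefs.archExp (Fp L) L (IsCMField.complexConj L) (n + n) (hermD L e dV hdV dW hdW) hX s = K2LiuArchOneParameterOrbitDefs.archEmb (Fp L) L (IsCMField.complexConj L) (n + n) (hermD L e dV hdV dW hdW) (ψ ((uFormGroup (Fin 2) (Fin 2)).expMem ⟨((s • Y : ↥(uFormGroup (Fin 2) (Fin 2)).lie.toSubmodule) : Matrix (Fin 2 ⊕ Fin 2) (Fin 2 ⊕ Fin 2) ℂ), (s • Y).2⟩ : UForm (Fin 2) (Fin 2)))) ∧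
        HasDerivAt (fun t' : ℝ => ((((DoubledWeilDetTwist.detChar L e dV hdV hdV0 dW hdW hdW0 α) (K2LiuArchOneParameterOrbitDefs.archExp (Fp L) L (IsCMField.complexConj L) (n + n) (hermD L e dV hdV dW hdW) hX t')) : ℂˣ) : ℂ)) c 0 := by
  letI : LieRing (Matrix (Fin 2 ⊕ Fin 2) (Fin 2 ⊕ Fin 2) ℂ) := LieRing.ofAssociativeRing
  intro σ
  refine ⟨((placeSec L (IsCMField.complexConj L) (n + n) (IsCMField.complexConj_ne_one L) (cmPlaceOver L) (cmPlaceOver_smul L) _ (gramD_gram_realDiagonal_entry_ne_zero L e dV hdV dW hdW hdV0 hdW0) (complexConj_imagUnit L) (imagUnit_ne_zero L) σ (cmPlaceOver_comap L) (gramD_eq_diagonal_cm L e dV hdV dW hdW) (J := hermD L e dV hdV dW hdW) rfl (complexConj_smul_infinitePlace L)).comp (UForm.relabel (Fin 2) (Fin 2) (PosIdx (signVec (cmPlaceOver L) (fun k => Sum.elim (cmGramEntry L e dV hdV dW hdW) (-cmGramEntry L e dV hdV dW hdW) ((LocalSplitting.e₂ n).symm k)) (imagUnit L) σ)) (NegIdx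 (signVec (cmPlaceOver L) (fun k => Sum.elim (cmGramEntry L e dV hdV dW hdW) (-cmGramEntry L e dV hdV dW hdW) ((LocalSplitting.e₂ n).symm k)) (imagUnit L) σ)) (eSp σ) (eSq σ)).toMonoidHom), hsec_placeSec_relabel L e dV hdV hdV0 dW hdW hdW0 eW e' dV' hdV' hdV'0 σ (y σ) (hy σ) (hz σ) (eP₀ σ) (eQ₀ σ) (hE σ) (eSp σ) (eSq σ), fun Y => ?_⟩
  obtain ⟨X, hX, hcurve, hXw⟩ := exists_archSkew_archExp_eq_placeSecJ_expMem L e dV hdV hdV0 dW hdW hdW0 σ (eSp σ).symm (eSq σ).symm Y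
  refine ⟨X, hX, _, hDX σ Y X hX hcurve hXw, fun s => ?_, hasDerivAt_coe_detChar_archExp L e dV hdV hdV0 dW hdW hdW0 σ (eSp σ).symm (eSq σ).symm Y hX hcurve α hα⟩
  rw [hcurve s, placeSecJ_inl, MonoidHom.comp_apply, relabel_symm_symm_apply]
  rfl


end GenericSinglePlace

end Summit.HodgeConjecture.HodgeConjecture.Cruxes.HLiu418.K2LiuArchSWDataDerivLettersDirected

end
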